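import Summits.Parity.GeneralizedHardyLittlewood.Theorems.MaynardProductExactGlue
import Summits.Parity.GeneralizedHardyLittlewood.Theorems.MaynardProductExactNumLB3749
import Summits.Parity.GeneralizedHardyLittlewood.Theorems.MaynardProductExactDenUB3750

/-! # Route `MaynardProductExact` — TARGET `HTwoLe34052` (stmt-Parity-19282) CLOSED

`H₂ ≤ 34 052`: for infinitely many `n`, `p_{n+2} ≤ p_n + 34 052` — the rung F-P1.R4 target of
`route-Parity-MaynardProductExact`, obtained BY NAME as the route's proved reduction
`hTwoLe34052_of : NumLB3749 → DenUB3750 → Tuple3750 → HTwoLe34052` (`Theorems/MaynardProductExactGlue.lean`: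
Bombieri–Vinogradov at level `ϑ = 1/4 + 2/M`, Maynard Prop. 4.2 / PM8b Thm 3.8, certificate glue `M_3750 > 8`)
applied to the two landed kernel certificates `numLB3749_proof` (stmt-Parity-19245) and `denUB3750_proof`
(stmt-Parity-19251) and the admissible-tuple support `tuple3750_holds` (stmt-Parity-19287).
Rung bookkeeping only (closes_target class rung, summit_closing false); no summit is proved by this file. -/

namespace Summit.Parity.GeneralizedHardyLittlewood.MaynardProductExactHTwoLe34052

open Summit.Parity.GeneralizedHardyLittlewood.Theses.MaynardProductExact

/-- **Target `HTwoLe34052` (stmt-Parity-19282), by name:** `∃ᶠ n in atTop, p_{n+2} ≤ p_n + 34052`, from the two kernel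
certificates `NumLB3749`, `DenUB3750` and the tuple support `Tuple3750` through the route's proved reduction `hTwoLe34052_of`. -/
theorem hTwoLe34052_proof : Summit.Parity.GeneralizedHardyLittlewood.Theses.MaynardProductExact.HTwoLe34052 :=
  hTwoLe34052_of MaynardProductExactNumLB3749.numLB3749_proof MaynardProductExactDenUB3750.denUB3750_proof
    tuple3750_holds

end Summit.Parity.GeneralizedHardyLittlewood.MaynardProductExactHTwoLe34052
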